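import Summits.Langlands.Langlands.Theses.ExteriorSquareAscent
import Summits.Langlands.Langlands.Theorems.ExteriorSquareAscentReducibleInducesSquareStubLineHecke
import Summits.Langlands.Langlands.Theorems.ExteriorSquareAscentReducibleInducesSquareStubPlanesBlocks
import Summits.Langlands.Langlands.Theorems.ExteriorSquareAscentReducibleInducesSquareStubPlanesAmbient
import Summits.Langlands.Langlands.Theorems.ExteriorSquareAscentReducibleInducesSquareStubPlanesHecke
import Summits.Langlands.Langlands.Theorems.ExteriorSquareAscentReducibleInducesSquareStubWedgeTwoCuspidal
import Summits.Langlands.Langlands.Theorems.ExteriorSquareAscentReducibleInducesSquareStubNoLineAnalytic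
import Summits.Langlands.Langlands.Theorems.ExteriorSquareAscentReducibleInducesSquareStubNoPlanesAnalytic
import Literature.NumberTheory.Automorphic.AsgariRaghuramExteriorSquareCuspidalProofs
import Literature.NumberTheory.Automorphic.BockleHuiIrreducibleGL3AnalyticProofs

/-!
# `ReducibleInducesSquareGivenJSAR` (stmt-Langlands-18147): crux 3 `ReducibleInducesSquare` of route
# `ExteriorSquareAscent` from its three promoted literature inputs — the closing theorem of line `Sketch`

Route `route-Langlands-ExteriorSquareAscent`, summit `Langlands`.  The support item
`Summit.Langlands.Langlands.Theses.ExteriorSquareAscent.ReducibleInducesSquareGivenJSAR` is by definition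
`PairLBoundaryJS → PairLPoleJS → WedgeTwoNotCuspidalAR → ReducibleInducesSquare` (Jacquet–Shalika (2.2), (2.3)
for Borel–Jacquet data and Asgari–Raghuram Thm. 1 (i)⇒(iii), the three XL-apex inputs promoted to route items
stmt-Langlands-13622 / 19093 / 18128 by the route-choice planners on 2026-08-17), and this file PROVES it: it is
the composition `ReducibleInducesSquare_of` of the registered skeleton `Cruxes/ReducibleInducesSquare/Lines/Sketch.lean`
with its ten stubs replaced by the landed theorems of the line —

* `stub_lineHecke` (Galois → Hecke for a stable LINE; Böckle–Hui Thm 1.1, proved in the tree),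
* `stub_planesBlocks`, `stub_planesAmbient`, `stub_planesHecke` (Galois → the pair-product Hecke character for two
  complementary stable PLANES: block form, the `E`-rational ambient `det S ⊕ det T ⊕ S ⊗ T`, Böckle–Hui),
* `stub_wedgeTwoCuspidal` (the CUSPIDAL `GL₆` datum `∧²π` from Asgari–Raghuram and the crux's two `¬` hypotheses),
* `stub_noLineAnalytic` (the (3,1) case is empty: eight-term Euler identity, pole count on and off the unitary axis),
* `stub_noPlanesAnalytic` (the (2,2) case is empty: the 46-term dual-pair Rankin–Selberg syzygy, pole count on and
  off the unitary axis; helpers `stub_pairPackage`, `stub_glOnePackage`, `stub_twoTwoIdentity`),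

plus the two pieces proved in the skeleton itself and re-proved here verbatim: `E`-rationality of an a.e.-compatible
`ρ` from the Hecke field (`isRationalOver_of_heckeField`, BH §3.1 for `n = 4` with the half-integral
C-normalisation) and the `3 + 1 / 2 + 2` case split (`twoPlusTwo_of_reducible`).  Bridges: `PairLBoundaryJS` and
`PairLPoleJS` ARE the named facts `JacquetShalika1981_partialPairL_{boundary,pole}_repData` (definitionally;
cf. `pairLBoundaryJS_iff := Iff.rfl` in `Theorems/ExteriorSquareAscentRestOfReciprocityGivenJS`), and
`WedgeTwoNotCuspidalAR` IS `AsgariRaghuram2007_notCuspidal_wedgeTwo_imp` (definitionally), whose Hecke-character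
form is `AsgariRaghuram2007_selfDual_or_selfTwist_of_wedgeTwo_not_cuspidal_of_notCuspidal_wedgeTwo_imp`.

So, GIVEN the three inputs, BOTH reducible shapes of a compatible semisimple `ρ` are contradictory for a cuspidal
`π` on `GL₄` with a Hecke field that is neither essentially self-dual nor quadratically self-twisted, over ANY
number field and without any weight hypothesis; the crux's conclusion `∃ (L, P) …` is reached ex falso.  The main
theorem `reducibleInducesSquareGivenJSAR` has type LITERALLY the route decl.
-/

set_option linter.dupNamespace false -- `Summit.Langlands.Langlands` is the mandated namespace

noncomputable section

namespace Summit.Langlands.Langlands.Cruxes.ReducibleInducesSquare.Sketch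

open Summit.Langlands.Langlands.Theses.ExteriorSquareAscent
open Literature.NumberTheory.GaloisRepresentations Literature.NumberTheory.Automorphic
open NumberField IsDedekindDomain Filter Polynomial
open scoped Classical MatrixGroups

/-! ## 1. `E`-rationality from the Hecke field (BH §3.1 for `n = 4`) -/

section Rational

variable {K : Type} [Field K] [NumberField K] {hcpt : isCompact_glFiniteIntegralLevel 4 K}
  {ℓ : ℕ} [Fact ℓ.Prime]

/-- `e₁{a, b, c, d}`. [folklore] -/
theorem esymm_one_quad (a b c d : ℂ) : ({a, b, c, d} : Multiset ℂ).esymm 1 = a + b + c + d := by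
  simp [Multiset.esymm, Multiset.powersetCard_one, Multiset.insert_eq_cons]
  ring

/-- `e₂{a, b, c, d}`. [folklore] -/
theorem esymm_two_quad (a b c d : ℂ) :
    ({a, b, c, d} : Multiset ℂ).esymm 2 = a * b + a * c + a * d + b * c + b * d + c * d := by
  simp [Multiset.esymm, Multiset.powersetCard_one, Multiset.insert_eq_cons, Multiset.powersetCard_cons]
  ring

/-- `e₃{a, b, c, d}`. [folklore] -/
theorem esymm_three_quad (a b c d : ℂ) :
    ({a, b, c, d} : Multiset ℂ).esymm 3 = a * b * c + a * b * d + a * c * d + b * c * d := by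
  simp [Multiset.esymm, Multiset.powersetCard_one, Multiset.insert_eq_cons, Multiset.powersetCard_cons]
  ring

/-- `e₄{a, b, c, d}`. [folklore] -/
theorem esymm_four_quad (a b c d : ℂ) : ({a, b, c, d} : Multiset ℂ).esymm 4 = a * b * c * d := by
  simp [Multiset.esymm, Multiset.powersetCard_one, Multiset.insert_eq_cons, Multiset.powersetCard_cons]
  ring

/-- A multiset of cardinality four is `{a, b, c, d}`. [folklore] -/
theorem exists_eq_quad_of_card_eq_four {α : Multiset ℂ} (h : Multiset.card α = 4) :
    ∃ a b c d : ℂ, α = {a, b, c, d} := by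
  obtain ⟨a, ha⟩ : ∃ a, a ∈ α := Multiset.card_pos_iff_exists_mem.1 (by omega)
  obtain ⟨β, rfl⟩ := Multiset.exists_cons_of_mem ha
  have hβ : Multiset.card β = 3 := by
    rw [Multiset.card_cons] at h
    omega
  obtain ⟨b, c, d, rfl⟩ := Multiset.card_eq_three.1 hβ
  exact ⟨a, b, c, d, rfl⟩

/-- **`E`-rationality of an a.e.-compatible rank-four `ρ` from the Hecke field of `π` (BH §3.1, `n = 4`).**
If the C-normalised Hecke coefficients `q_v^{i(4-i)/2} e_i(t_{π,v})` lie in the subfield `E ⊆ ℂ` for almost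
all `v` (the crux's Hecke-field hypothesis) and `ρ` is a.e. Satake–Frobenius compatible with `(π, ι)`
(`arithFrobPolyOfSatake ι q_v 4`: roots `ι⁻¹((q_v^{3/2} a)⁻¹)`), then `ρ` is `E`-rational for `ι⁻¹|_E`: with
`t_{π,v} = {a, b, c, d}` (non-zero) the Frobenius polynomial is
`X⁴ - ι⁻¹(q^{3/2}e₃/(q⁶e₄)) X³ + ι⁻¹(q²e₂/(q⁷e₄)) X² - ι⁻¹(q^{3/2}e₁/(q⁹ e₄)) X + ι⁻¹(1/(q⁶e₄))`, whose
coefficients lie in `ι⁻¹(E)` because `q^{3/2}e₁, q²e₂, q^{3/2}e₃, e₄, q ∈ E`. [cite: BockleHui2025, §3.1] -/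
theorem isRationalOver_of_heckeField
    (π : AutomorphicRepData (AutomorphyDatum.gl 4 K hcpt)) (ι : PadicAlgCl ℓ ≃+* ℂ)
    (ρ : FramedGaloisRep K (PadicAlgCl ℓ) 4) (E : Subfield ℂ)
    (hE : ∀ᶠ v : HeightOneSpectrum (𝓞 K) in cofinite, ∀ α : Multiset ℂ, π.HasSatakeParamAt v α →
      ∀ i ≤ 4, ((((Real.sqrt (v.residueCard : ℝ)) : ℝ) : ℂ) ^ (i * (4 - i))) * α.esymm i ∈ E)
    (hcomp : ∀ᶠ v : HeightOneSpectrum (𝓞 K) in cofinite, ∃ α : Multiset ℂ, π.HasSatakeParamAt v α ∧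
      ρ.IsUnramifiedAt v ∧ ρ.HasFrobCharpolyAt v (arithFrobPolyOfSatake ι v.residueCard 4 α)) :
    ρ.IsRationalOver ((ι.symm : ℂ ≃+* PadicAlgCl ℓ).toRingHom.comp E.subtype) := by
  filter_upwards [hE, hcomp] with v hEv hv
  obtain ⟨α, hα, hunr, hP⟩ := hv
  refine ⟨hunr, ?_⟩
  have hne : ∀ a ∈ α, a ≠ 0 := hasSatakeParamAt_ne_zero_holds hα
  have ht1 := hEv _ hα 1 (by norm_num)
  have ht2 := hEv _ hα 2 (by norm_num)
  have ht3 := hEv _ hα 3 (by norm_num)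
  have ht4 := hEv _ hα 4 le_rfl
  obtain ⟨a, b, c, d, rfl⟩ := exists_eq_quad_of_card_eq_four hα.card_eq
  have ha : a ≠ 0 := hne a (by simp)
  have hb : b ≠ 0 := hne b (by simp)
  have hc : c ≠ 0 := hne c (by simp)
  have hd : d ≠ 0 := hne d (by simp)
  rw [esymm_one_quad] at ht1
  rw [esymm_two_quad] at ht2
  rw [esymm_three_quad] at ht3
  rw [esymm_four_quad] at ht4
  norm_num at ht1 ht2 ht3 ht4
  -- `√q`
  set q : ℕ := v.residueCard with hq
  set sq : ℂ := ((Real.sqrt (q : ℝ) : ℝ) : ℂ) with hsq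
  have hsq2 : sq ^ 2 = (q : ℂ) := by
    rw [hsq, ← Complex.ofReal_pow, Real.sq_sqrt (Nat.cast_nonneg _), Complex.ofReal_natCast]
  have hsq0 : sq ≠ 0 := by
    rw [hsq, Complex.ofReal_ne_zero]
    exact Real.sqrt_ne_zero'.2 (by exact_mod_cast lt_trans zero_lt_one v.one_lt_residueCard)
  have hqE : sq ^ 2 ∈ E := by rw [hsq2]; exact natCast_mem E q
  have he4 : a * b * c * d ∈ E := by simpa using ht4
  have habcd : a * b * c * d ≠ 0 := mul_ne_zero (mul_ne_zero (mul_ne_zero ha hb) hc) hd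
  -- the inverse roots `(q^{3/2} x)⁻¹` and their symmetric functions
  set u : ℂ := (sq ^ 3 * a)⁻¹ with hu
  set w : ℂ := (sq ^ 3 * b)⁻¹ with hw
  set z : ℂ := (sq ^ 3 * c)⁻¹ with hz
  set y : ℂ := (sq ^ 3 * d)⁻¹ with hy
  have hS1 : u + w + z + y ∈ E := by
    have e : u + w + z + y =
        (sq ^ 3 * (a * b * c + a * b * d + a * c * d + b * c * d)) *
          (sq ^ 2 * sq ^ 2 * sq ^ 2 * (a * b * c * d))⁻¹ := by
      rw [hu, hw, hz, hy]
      field_simp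
      ring
    rw [e]
    exact mul_mem ht3 (inv_mem (mul_mem (mul_mem (mul_mem hqE hqE) hqE) he4))
  have hS2 : u * w + u * z + u * y + w * z + w * y + z * y ∈ E := by
    have e : u * w + u * z + u * y + w * z + w * y + z * y =
        (sq ^ 4 * (a * b + a * c + a * d + b * c + b * d + c * d)) *
          (sq ^ 2 * sq ^ 2 * sq ^ 2 * sq ^ 2 * sq ^ 2 * (a * b * c * d))⁻¹ := by
      rw [hu, hw, hz, hy]
      field_simp
      ring
    rw [e]
    exact mul_mem ht2
      (inv_mem (mul_mem (mul_mem (mul_mem (mul_mem (mul_mem hqE hqE) hqE) hqE) hqE) he4))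
  have hS3 : u * w * z + u * w * y + u * z * y + w * z * y ∈ E := by
    have e : u * w * z + u * w * y + u * z * y + w * z * y =
        (sq ^ 3 * (a + b + c + d)) *
          (sq ^ 2 * sq ^ 2 * sq ^ 2 * sq ^ 2 * sq ^ 2 * sq ^ 2 * (a * b * c * d))⁻¹ := by
      rw [hu, hw, hz, hy]
      field_simp
      ring
    rw [e]
    exact mul_mem ht1
      (inv_mem (mul_mem (mul_mem (mul_mem (mul_mem (mul_mem (mul_mem hqE hqE) hqE) hqE) hqE) hqE) he4))
  have hS4 : u * w * z * y ∈ E := by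
    have e : u * w * z * y =
        (sq ^ 2 * sq ^ 2 * sq ^ 2 * sq ^ 2 * sq ^ 2 * sq ^ 2 * (a * b * c * d))⁻¹ := by
      rw [hu, hw, hz, hy]
      field_simp
    rw [e]
    exact inv_mem (mul_mem (mul_mem (mul_mem (mul_mem (mul_mem (mul_mem hqE hqE) hqE) hqE) hqE) hqE) he4)
  refine ⟨X ^ 4 - C (⟨u + w + z + y, hS1⟩ : E) * X ^ 3 +
    C (⟨u * w + u * z + u * y + w * z + w * y + z * y, hS2⟩ : E) * X ^ 2 -
    C (⟨u * w * z + u * w * y + u * z * y + w * z * y, hS3⟩ : E) * X +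
    C (⟨u * w * z * y, hS4⟩ : E), ?_⟩
  intro 𝔓 h𝔓 σ hσ
  rw [hP 𝔓 h𝔓 σ hσ]
  simp only [arithFrobPolyOfSatake, Multiset.insert_eq_cons, Multiset.map_cons,
    Multiset.map_singleton, Multiset.prod_cons, Multiset.prod_singleton, Polynomial.map_add,
    Polynomial.map_sub, Polynomial.map_mul, Polynomial.map_pow, map_X, map_C,
    RingHom.coe_comp, Function.comp_apply, RingEquiv.toRingHom_eq_coe, RingEquiv.coe_toRingHom,
    Subfield.coe_subtype, map_add, map_mul]
  have h41 : (4 - 1 : ℕ) = 3 := rfl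
  rw [h41, ← hsq, ← hu, ← hw, ← hz, ← hy]
  ring

/-- The `∃`-form consumed by the stubs: a compatible `ρ` of a `π` with a Hecke field is `E`-rational for some
number field `E`. [cite: BockleHui2025, §3.1] -/
theorem exists_isRationalOver_of_heckeField
    (π : AutomorphicRepData (AutomorphyDatum.gl 4 K hcpt)) (ι : PadicAlgCl ℓ ≃+* ℂ)
    (ρ : FramedGaloisRep K (PadicAlgCl ℓ) 4)
    (hE : ∃ E : Subfield ℂ, FiniteDimensional ℚ E ∧ ∀ᶠ v : HeightOneSpectrum (𝓞 K) in cofinite,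
      ∀ α : Multiset ℂ, π.HasSatakeParamAt v α →
        ∀ i ≤ 4, ((((Real.sqrt (v.residueCard : ℝ)) : ℝ) : ℂ) ^ (i * (4 - i))) * α.esymm i ∈ E)
    (hcomp : ∀ᶠ v : HeightOneSpectrum (𝓞 K) in cofinite, ∃ α : Multiset ℂ, π.HasSatakeParamAt v α ∧
      ρ.IsUnramifiedAt v ∧ ρ.HasFrobCharpolyAt v (arithFrobPolyOfSatake ι v.residueCard 4 α)) :
    ∃ (E : Type) (_ : Field E) (_ : NumberField E) (e : E →+* PadicAlgCl ℓ), ρ.IsRationalOver e := by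
  obtain ⟨E, hfd, hE⟩ := hE
  haveI : FiniteDimensional ℚ E := hfd
  haveI : NumberField E := NumberField.mk
  exact ⟨E, inferInstance, inferInstance, _, isRationalOver_of_heckeField π ι ρ E hE hcomp⟩

end Rational

/-! ## 2. The case split `3 + 1` / `2 + 2` -/

/-- **A reducible semisimple representation of dimension 4 with no stable line is `2 + 2`.** [folklore] -/
theorem twoPlusTwo_of_not_isIrreducible {k G V : Type*} [Field k] [Monoid G] [AddCommGroup V]
    [Module k V] [FiniteDimensional k V] (ρ : Representation k G V) (h4 : Module.finrank k V = 4)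
    (hss : ρ.IsSemisimpleRepresentation) (hirr : ¬ ρ.IsIrreducible)
    (hno1 : ∀ W : Subrepresentation ρ, Module.finrank k W.toSubmodule ≠ 1) :
    ∃ W₁ W₂ : Subrepresentation ρ, IsCompl W₁ W₂ ∧ Module.finrank k W₁.toSubmodule = 2 ∧
      Module.finrank k W₂.toSubmodule = 2 := by
  classical
  have hbot : (⊥ : Subrepresentation ρ).toSubmodule = ⊥ := rfl
  have htop : (⊤ : Subrepresentation ρ).toSubmodule = ⊤ := rfl
  have hV : Nontrivial V := Module.nontrivial_of_finrank_pos (R := k) (by omega)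
  have hnt : (⊥ : Subrepresentation ρ) ≠ ⊤ := by
    intro h
    have h' := congrArg Subrepresentation.toSubmodule h
    rw [hbot, htop] at h'
    exact bot_ne_top h'
  obtain ⟨W, hWb, hWt⟩ : ∃ W : Subrepresentation ρ, W ≠ ⊥ ∧ W ≠ ⊤ := by
    by_contra h
    push Not at h
    apply hirr
    haveI : Nontrivial (Subrepresentation ρ) := ⟨⟨⊥, ⊤, hnt⟩⟩
    exact ⟨fun W => (Classical.em (W = ⊥)).imp_right (h W)⟩
  haveI := hss
  obtain ⟨W', hWW'⟩ := exists_isCompl W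
  have hWb' : W.toSubmodule ≠ ⊥ := fun h =>
    hWb (Subrepresentation.toSubmodule_injective (h.trans hbot.symm))
  have hWt' : W.toSubmodule ≠ ⊤ := fun h =>
    hWt (Subrepresentation.toSubmodule_injective (h.trans htop.symm))
  have hinf : W.toSubmodule ⊓ W'.toSubmodule = ⊥ := by
    have := hWW'.disjoint
    rw [disjoint_iff] at this
    exact (congrArg Subrepresentation.toSubmodule this).trans hbot
  have hsup : W.toSubmodule ⊔ W'.toSubmodule = ⊤ := by
    have := hWW'.codisjoint
    rw [codisjoint_iff] at this
    exact (congrArg Subrepresentation.toSubmodule this).trans htop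
  have hsum : Module.finrank k W.toSubmodule + Module.finrank k W'.toSubmodule = 4 := by
    have := Submodule.finrank_sup_add_finrank_inf_eq W.toSubmodule W'.toSubmodule
    rw [hinf, hsup, finrank_top, finrank_bot, h4] at this
    omega
  have hpos : 0 < Module.finrank k W.toSubmodule := by
    rw [pos_iff_ne_zero, Ne, Submodule.finrank_eq_zero]
    exact hWb'
  have hlt : Module.finrank k W.toSubmodule < 4 := by
    rw [← h4]
    exact Submodule.finrank_lt hWt'
  have h1 := hno1 W
  have h1' := hno1 W'
  exact ⟨W, W', hWW', by omega, by omega⟩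

/-- The framed Galois case: a reducible semisimple `ρ : Γ_K → GL₄(ℚ̄_ℓ)` with no stable line has two
complementary stable planes. [folklore] -/
theorem twoPlusTwo_of_reducible {K : Type} [Field K] {ℓ : ℕ} [Fact ℓ.Prime]
    (ρ : FramedGaloisRep K (PadicAlgCl ℓ) 4) (hss : ρ.toGaloisRep.IsSemisimple)
    (hirr : ¬ ρ.toGaloisRep.IsIrreducible)
    (hno1 : ∀ W : Subrepresentation ρ.toGaloisRep.toRepresentation,
      Module.finrank (PadicAlgCl ℓ) W.toSubmodule ≠ 1) :
    ∃ W₁ W₂ : Subrepresentation ρ.toGaloisRep.toRepresentation, IsCompl W₁ W₂ ∧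
      Module.finrank (PadicAlgCl ℓ) W₁.toSubmodule = 2 ∧ Module.finrank (PadicAlgCl ℓ) W₂.toSubmodule = 2 :=
  twoPlusTwo_of_not_isIrreducible ρ.toGaloisRep.toRepresentation (Module.finrank_fin_fun (PadicAlgCl ℓ))
    hss hirr hno1

/-! ## 3. The crux from the three named facts, by the landed stubs -/

/-- **`ReducibleInducesSquare` granting Jacquet–Shalika (2.2)/(2.3) for Borel–Jacquet data and Asgari–Raghuram
(i)⇒(iii) in Hecke-character form** — the composition `ReducibleInducesSquare_of` of the line `Sketch` with its stubs
by name.  Fix `K, π, ℓ, ι, ρ` as in the crux with `ρ` reducible; `stub_wedgeTwoCuspidal` gives the cuspidal `Π`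
on `GL₆`; a stable line is refuted by `stub_lineHecke` + `stub_noLineAnalytic`, two complementary stable planes
(`twoPlusTwo_of_reducible`) by `stub_planesBlocks` + `stub_planesAmbient` + `stub_planesHecke` +
`stub_noPlanesAnalytic` (with `¬` ess-self-dual moved from `GL(1)` data to Hecke characters by
`exists_cuspidal_glOne_hasSatakeParamAt_valueAtUniformizer`). [cite: Shavali2026GL4, Props. 4.1–4.2] -/
theorem reducibleInducesSquare_of_JS_of_AR
    (hJ22 : Literature.NumberTheory.Automorphic.JacquetShalika1981_partialPairL_boundary_repData)
    (hJ23 : Literature.NumberTheory.Automorphic.JacquetShalika1981_partialPairL_pole_repData)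
    (hAR : Literature.NumberTheory.Automorphic.AsgariRaghuram2007_selfDual_or_selfTwist_of_wedgeTwo_not_cuspidal) :
    Summit.Langlands.Langlands.Theses.ExteriorSquareAscent.ReducibleInducesSquare := by
  intro K _ _ h1 hcpt π hHF hNE hST ℓ _ ι ρ hss hcomp hirr
  exfalso
  have h6 : isCompact_glFiniteIntegralLevel 6 K := isCompact_glFiniteIntegralLevel_holds 6 K
  -- the cuspidal exterior square
  obtain ⟨P6, hP6⟩ := stub_wedgeTwoCuspidal K h1 hcpt h6 π hAR hNE hST
  -- `E`-rationality of `ρ`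
  have hrat : ∃ (E : Type) (_ : Field E) (_ : NumberField E) (e : E →+* PadicAlgCl ℓ),
      ρ.IsRationalOver e :=
    exists_isRationalOver_of_heckeField π.1 ι ρ hHF hcomp
  by_cases hline : ∃ W : Subrepresentation ρ.toGaloisRep.toRepresentation,
      Module.finrank (PadicAlgCl ℓ) W.toSubmodule = 1
  · -- (3,1): a stable line gives a Hecke character among the Satake eigenvalues — impossible
    obtain ⟨W, hW1⟩ := hline
    obtain ⟨μ, hμ⟩ := stub_lineHecke K hcpt π ℓ ι ρ hss hcomp hrat W hW1
    exact stub_noLineAnalytic K hcpt h6 π P6 hJ22 hP6 μ hμ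
  · -- (2,2): two complementary stable planes give a pair-product Hecke character — impossible
    push Not at hline
    obtain ⟨W₁, W₂, hc, hW₁, hW₂⟩ := twoPlusTwo_of_reducible ρ hss hirr hline
    obtain ⟨S, T, hprod, hker⟩ := stub_planesBlocks K ℓ ρ W₁ W₂ hc hW₁ hW₂
    have hunr : ∀ᶠ v : HeightOneSpectrum (𝓞 K) in cofinite, ρ.IsUnramifiedAt v :=
      hcomp.mono fun v hv => hv.choose_spec.2.1
    obtain ⟨ψ, ρ', hψ, hwd, hrat'⟩ := stub_planesAmbient K ℓ ρ S T hprod hker hunr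
    have hdvd : ∀ g : Field.absoluteGaloisGroup K, FramedRep.charpoly S g ∣ FramedRep.charpoly ρ g :=
      fun g => Dvd.intro _ (hprod g).symm
    obtain ⟨χ, hχ⟩ := stub_planesHecke K hcpt π ℓ ι ρ hcomp hrat S hdvd ψ ρ' hψ hwd hrat'
    have hNE' : ¬ ∃ e : HeckeCharacter K, ∀ᶠ v : HeightOneSpectrum (𝓞 K) in cofinite,
        ∀ α : Multiset ℂ, π.1.HasSatakeParamAt v α →
          α.map (fun a => a⁻¹) = α.map (fun a => e.valueAtUniformizer v * a) := by
      rintro ⟨e, he⟩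
      obtain ⟨η, hη⟩ := exists_cuspidal_glOne_hasSatakeParamAt_valueAtUniformizer h1 e
      refine hNE ⟨η, ?_⟩
      filter_upwards [he, hη] with v hv hηv α hα
      exact ⟨_, hηv, hv α hα⟩
    exact stub_noPlanesAnalytic K hcpt h6 π P6 hJ22 hJ23 hP6 hNE' χ hχ

/-! ## 4. The route item -/

/-- **Item stmt-Langlands-18147 `ReducibleInducesSquareGivenJSAR` — PROVED.**  The route's GL(1)-datum form
`WedgeTwoNotCuspidalAR` of Asgari–Raghuram is, definitionally, the named fact
`AsgariRaghuram2007_notCuspidal_wedgeTwo_imp`, turned into its Hecke-character form by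
`AsgariRaghuram2007_selfDual_or_selfTwist_of_wedgeTwo_not_cuspidal_of_notCuspidal_wedgeTwo_imp`; `PairLBoundaryJS`,
`PairLPoleJS` are definitionally the Jacquet–Shalika facts; then `reducibleInducesSquare_of_JS_of_AR`.
The type is LITERALLY the route decl. [cite: Shavali2026GL4, Props. 4.1–4.2]
[cite: AsgariRaghuram2007, Theorem 1 (i) ⇒ (iii)] [cite: ArthurClozelAMS120, Ch. 3 §2 (2.2)–(2.3)] -/
theorem reducibleInducesSquareGivenJSAR :
    Summit.Langlands.Langlands.Theses.ExteriorSquareAscent.ReducibleInducesSquareGivenJSAR := by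
  intro h22 h23 hAR
  refine reducibleInducesSquare_of_JS_of_AR h22 h23
    (AsgariRaghuram2007_selfDual_or_selfTwist_of_wedgeTwo_not_cuspidal_of_notCuspidal_wedgeTwo_imp ?_)
  intro F _ _ h1 h4 h6 π hno
  exact hAR F h1 h4 h6 π hno

end Summit.Langlands.Langlands.Cruxes.ReducibleInducesSquare.Sketch

end
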